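import Summits.AtomisticToContinuum.Crystallization.Theorems.ChartedPlanarOrderPairForceLipschitz
import Summits.AtomisticToContinuum.Crystallization.Theorems.ChartedPlanarOrderLayerForceLipschitz
import Summits.AtomisticToContinuum.Crystallization.Theorems.ChartedPlanarOrderPlanarLatticeSums
import Summits.AtomisticToContinuum.Crystallization.Theorems.ChartedPlanarOrderTubeMonotoneSplit
import Summits.AtomisticToContinuum.Crystallization.Theorems.ChartedPlanarOrderStackedUniform

-- PART A (lines 1–335 of lens-3 g24 `ChartedPlanarOrderPairModulus.lean`, sha256 54d68d2ec608f35d…): §1 one-dimensional lattice sums, §2 planar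
-- site sums; PART B (`…PairModulusB`) = §3–§5 (Gram positivity, layer-force Lipschitz bound, span/pair moduli). Split for the 400-line rule
-- by prover hand 1, gen 11 (--supports stmt-AtomisticToContinuum-26636); declarations byte-identical (gate-forced deltas: docstrings added on the undocumented small lemmas; `summable_inv_one_add_sq` made private — dedup twin in Literature WeilMellinPolyDecay).

/-!
# 7c′ᴾ — span moduli of the layer-pair force from a HEIGHT FLOOR (decomp-a2c lens-3 g24, task (v))

The remaining ANALYTIC content of slot 7c′ (`…TubeConvex`/`…TubeConvexSplit`/`…StraddleLipschitz`): the layer-pair force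
`v ↦ layerForce a b (−v)` (LJ 6–12, `…ProfileSlavingLJ`) is Lipschitz in the offset `v` of a layer pair of SPAN `s`, uniformly
along all `ρ`-tube profiles, with constant `τ s = K · s⁻⁶`, hence `Σ s³ τ s < ∞` — i.e. `…TubeMonotoneSplit.IsPairModulus a b w ρ τ`
with a summable third moment.  Everything is assembled from LANDED bricks:

* (o) `…PairForceLipschitz.pairForce_sub_le` — the per-site modulus `Φ(t) = 15 t⁻¹⁴ + 9 t⁻⁸` above the floor `t`;
* (p) `…LayerForceLipschitz.norm_layerForce_sub_le_of_floor`, `le_inner_offsetOf` — summing per-site moduli over site floors, and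
  the height of a span-`s` offset along a tube profile: `⟪ν, offsetOf h k l⟫ ≥ s (h₀ − ρ)`;
* (q) `…PlanarLatticeSums.norm_sq_site_ge`, `summable_inv_quad_sq`, `inv_pow_four_le_prod`, `inv_pow_seven_le`, `inv_sqrt_pow_two_mul`
  — the planar site floor `‖v + i a + j b‖² ≥ S := t² + q₁ (i + c₁)² + q₂ (j + c₂)²` (`q₁ = G/2‖b‖²`, `q₂ = G/2‖a‖²`, `G` the Gram
  determinant) and `c`-wise summability.

NEW here (the «lattice sum ∼ t⁻⁶ per unit coarea» estimate promised in (p)'s docstring):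
* §1 ★ `tsum_int_quadsq_le` — decay of the one-dimensional sum UNIFORM IN THE OFFSET: `Σ_{i∈ℤ} ((p + q(i+c)²)²)⁻¹ ≤ (2N+3) p⁻² + 2 q⁻² N⁻³`
  for every `N ≥ 1` (head of `2N+3` terms, tail by the telescoping `Σ_{n>N} n⁻⁴ ≤ N⁻³`);
* §2 ★ `tsum_sites_four_le`, `tsum_sites_seven_le`, `tsum_modulus_le` — uniform planar decay (product trick) and the modulus sum
  `Σ_{(i,j)} Φ(√S) ≤ (15 t⁻⁶ + 9) · lineBound² `;
* §3 `gram_pos`, `sqrt_siteSq_le_norm`, `summable_layer` — Gram positivity of independent periods, the site floors, summability of a layer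
  family at height `≥ t > 0`;
* §4 ★ `norm_layerForce_sub_le_of_height` — the UNIFORM Lipschitz bound of `layerForce a b` between two offsets of height `≥ t`;
* §5 ★★ `isPairModulus_of_heightFloor` / `pairModulus_of_heightFloor` (config level, explicit normal `ν` and floor `h₀ > ρ`; choosing
  `N = s`, `t = s(h₀ − ρ)` gives `τ s = spanConst · s⁻⁶`) and ★★ `pairModulus_of_cleanP_stacked` — for every `δ`-separated `IsCleanP aHi`
  (`aHi ≤ 8/7`, so lens-4's `IsCleanW` at `103/100`) stacked layered configuration with `‖a‖, ‖b‖ ≤ 17/16` and every tube radius `ρ < 19/50`,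
  via the uniform layer windows of (n) `…StackedUniform.stackedUniform` (floor `min(192/425, 8/17)·27/32 ≥ 19/50`).  This is the
  `∃ τ`-package consumed by `…StraddleLipschitz.tubeLipschitzData_of_pairModulus`; in particular it yields `PairModulusW' (17/16) ρ` and
  `PairModulusW (17/16) ρ` for all `ρ < 19/50` (so slot 7c′ at `ρ₀ = 1/40` reduces to its convexity half 7c′ᶜ alone) — that two-line
  corollary is left to the file importing both.

Design-neutral (no W′/W statement is imported); six real-valued `def`s (`lineBound`, `siteSq`, `modulus`, `qA`, `qB`, `spanConst`), no Props;
no instances, no notation; sorry-free.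
-/

open Finset Metric
open scoped RealInnerProductSpace
open Summit.AtomisticToContinuum.Crystallization.Theorems.ChartedPlanarOrderRigidityDoor (E3)
open Summit.AtomisticToContinuum.Crystallization.Theorems.ChartedPlanarOrderDensityDichotomy (IsSep μS)
open Summit.AtomisticToContinuum.Crystallization.Theorems.ChartedPlanarOrderDoorLayered (Layered)
open Summit.AtomisticToContinuum.Crystallization.Theorems.ChartedPlanarOrderCleanScaleP (IsCleanP linearIndependent_of_cleanP_stacked)
open Summit.AtomisticToContinuum.Crystallization.Theorems.ChartedPlanarOrderProfileSlavingLJ (pairForce layerForce incr offsetOf tube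
  IsStacked)
open Summit.AtomisticToContinuum.Crystallization.Theorems.ChartedPlanarOrderPairForceLipschitz (pairForce_sub_le norm_pairForce_le_of_le)
open Summit.AtomisticToContinuum.Crystallization.Theorems.ChartedPlanarOrderLayerForceLipschitz (le_inner_offsetOf
  norm_layerForce_sub_le_of_floor)
open Summit.AtomisticToContinuum.Crystallization.Theorems.ChartedPlanarOrderStraddleSummable (exists_coeffs_of_inner_eq_zero)
open Summit.AtomisticToContinuum.Crystallization.Theorems.ChartedPlanarOrderTubeMonotoneSplit (IsPairModulus)
open Summit.AtomisticToContinuum.Crystallization.Theorems.ChartedPlanarOrderStackedUniform (stackedUniform)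
open Summit.AtomisticToContinuum.Crystallization.Theorems.ChartedPlanarOrderPlanarLatticeSums (summable_inv_quad_sq
  summable_inv_one_add_sq_sq inv_pow_four_le_prod inv_pow_seven_le inv_sqrt_pow_two_mul summable_sites_four summable_sites_seven
  summable_modulus_sites norm_sq_site_ge)

noncomputable section

namespace Summit.AtomisticToContinuum.Crystallization.Theorems.ChartedPlanarOrderPairModulus

/-! ## §1 One-dimensional lattice sums: decay uniform in the offset -/

/-- telescoping step: `1/(x+1)⁴ ≤ 1/x³ − 1/(x+1)³` for `x ≥ 1`. -/
theorem inv_pow_four_le_sub {x : ℝ} (hx : 1 ≤ x) : ((x + 1) ^ 4)⁻¹ ≤ x⁻¹ ^ 3 - (x + 1)⁻¹ ^ 3 := by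
  have hx0 : 0 < x := by linarith
  rw [inv_pow, inv_pow]
  have h1 : ((x + 1) ^ 3)⁻¹ = (x + 1) / (x + 1) ^ 4 := by
    rw [eq_div_iff (by positivity), show (x + 1) ^ 4 = (x + 1) ^ 3 * (x + 1) by ring,
      inv_mul_cancel_left₀ (by positivity)]
  have h2 : (x + 2) / (x + 1) ^ 4 ≤ (x ^ 3)⁻¹ := by
    rw [inv_eq_one_div, div_le_div_iff₀ (by positivity) (by positivity)]
    nlinarith [pow_pos hx0 2, pow_pos hx0 3]
  have h3 : ((x + 1) ^ 4)⁻¹ = (x + 2) / (x + 1) ^ 4 - (x + 1) / (x + 1) ^ 4 := by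
    rw [← sub_div, show x + 2 - (x + 1) = 1 by ring, one_div]
  rw [h3, h1]; linarith

/-- partial sums of the tail `Σ_{n ≥ N+1} n⁻⁴ ≤ N⁻³` (telescoping). -/
theorem sum_range_tail_four_le {N : ℕ} (hN : 1 ≤ N) (M : ℕ) :
    ∑ n ∈ range M, (((n : ℝ) + N + 1) ^ 4)⁻¹ ≤ (N : ℝ)⁻¹ ^ 3 - ((M : ℝ) + N)⁻¹ ^ 3 := by
  induction M with
  | zero => simp
  | succ M ih =>
    rw [sum_range_succ]
    have hN' : (1 : ℝ) ≤ N := by exact_mod_cast hN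
    have hx : (1 : ℝ) ≤ (M : ℝ) + N := by linarith [(Nat.cast_nonneg M : (0 : ℝ) ≤ M)]
    have key := inv_pow_four_le_sub hx
    push_cast
    rw [show (M : ℝ) + 1 + N = (M : ℝ) + N + 1 by ring]
    linarith

/-- the tail `Σ_{n ∈ ℕ} (n + N + 1)⁻⁴ ≤ N⁻³`. -/
theorem tsum_tail_four_le {N : ℕ} (hN : 1 ≤ N) : ∑' n : ℕ, (((n : ℝ) + N + 1) ^ 4)⁻¹ ≤ (N : ℝ)⁻¹ ^ 3 :=
  Real.tsum_le_of_sum_range_le (fun n => by positivity) fun M =>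
    (sum_range_tail_four_le hN M).trans (sub_le_self _ (by positivity))

/-- `Σ_{n ∈ ℕ} ((p + q n²)²)⁻¹ < ∞`. -/
theorem summable_nat_quadsq {p q : ℝ} (hp : 0 < p) (hq : 0 < q) :
    Summable fun n : ℕ => ((p + q * (n : ℝ) ^ 2) ^ 2)⁻¹ := by
  have h := (summable_inv_quad_sq hp hq 0).comp_injective Nat.cast_injective
  simpa [Function.comp_def] using h

/-- monotonicity of the summand in the distance. -/
theorem quadsq_anti {p q x y : ℝ} (hp : 0 < p) (hq : 0 < q) (hx : 0 ≤ x) (hxy : x ≤ y) :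
    ((p + q * y ^ 2) ^ 2)⁻¹ ≤ ((p + q * x ^ 2) ^ 2)⁻¹ :=
  inv_anti₀ (by positivity) (pow_le_pow_left₀ (by positivity)
    (by nlinarith [mul_le_mul_of_nonneg_left (pow_le_pow_left₀ hx hxy 2) hq.le]) 2)

/-- ★ decay of the shifted one-dimensional sum: `Σ_{n ≥ 1} ((p + q n²)²)⁻¹ ≤ N p⁻² + q⁻² N⁻³` for every `N ≥ 1`
(`N` terms of size `≤ p⁻²`, then the tail `q⁻² Σ_{n > N} n⁻⁴`). -/
theorem tsum_nat_succ_quadsq_le {p q : ℝ} (hp : 0 < p) (hq : 0 < q) {N : ℕ} (hN : 1 ≤ N) :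
    ∑' n : ℕ, ((p + q * ((n : ℝ) + 1) ^ 2) ^ 2)⁻¹ ≤ N * p⁻¹ ^ 2 + q⁻¹ ^ 2 * (N : ℝ)⁻¹ ^ 3 := by
  set g : ℕ → ℝ := fun n => ((p + q * ((n : ℝ) + 1) ^ 2) ^ 2)⁻¹ with hg
  have hgs : Summable g := by
    refine ((summable_nat_add_iff 1).2 (summable_nat_quadsq hp hq)).congr fun n => ?_
    simp [hg, Nat.cast_succ]
  have hhead : ∑ n ∈ range N, g n ≤ N * p⁻¹ ^ 2 := by
    have hle : ∀ n ∈ range N, g n ≤ p⁻¹ ^ 2 := fun n _ => by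
      rw [hg, inv_pow]
      exact inv_anti₀ (by positivity) (pow_le_pow_left₀ hp.le (le_add_of_nonneg_right (by positivity)) 2)
    calc ∑ n ∈ range N, g n ≤ ∑ _n ∈ range N, p⁻¹ ^ 2 := sum_le_sum hle
      _ = N * p⁻¹ ^ 2 := by rw [sum_const, card_range, nsmul_eq_mul]
  have htail : ∑' n, g (n + N) ≤ q⁻¹ ^ 2 * (N : ℝ)⁻¹ ^ 3 := by
    have hle : ∀ n, g (n + N) ≤ q⁻¹ ^ 2 * (((n : ℝ) + N + 1) ^ 4)⁻¹ := fun n => by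
      simp only [hg]; push_cast
      rw [inv_pow, ← mul_inv, show q ^ 2 * (((n : ℝ) + N + 1) ^ 4) = (q * ((n : ℝ) + N + 1) ^ 2) ^ 2 by ring]
      exact inv_anti₀ (by positivity) (pow_le_pow_left₀ (by positivity) (by linarith) 2)
    have hs : Summable fun n : ℕ => q⁻¹ ^ 2 * (((n : ℝ) + N + 1) ^ 4)⁻¹ :=
      (summable_of_sum_range_le (fun n => by positivity) fun M =>
        (sum_range_tail_four_le hN M).trans (sub_le_self _ (by positivity))).mul_left _
    calc ∑' n : ℕ, g (n + N) ≤ ∑' n : ℕ, q⁻¹ ^ 2 * (((n : ℝ) + N + 1) ^ 4)⁻¹ :=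
          ((summable_nat_add_iff N).2 hgs).tsum_le_tsum hle hs
      _ = q⁻¹ ^ 2 * ∑' n : ℕ, (((n : ℝ) + N + 1) ^ 4)⁻¹ := tsum_mul_left
      _ ≤ q⁻¹ ^ 2 * (N : ℝ)⁻¹ ^ 3 := mul_le_mul_of_nonneg_left (tsum_tail_four_le hN) (by positivity)
  rw [← hgs.sum_add_tsum_nat_add N]
  linarith

/-- the uniform one-dimensional bound. -/
def lineBound (p q : ℝ) (N : ℕ) : ℝ := (2 * N + 3) * p⁻¹ ^ 2 + 2 * (q⁻¹ ^ 2 * (N : ℝ)⁻¹ ^ 3)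

/-- `0 ≤ lineBound p q N`. [folklore] -/
theorem lineBound_nonneg (p q : ℝ) (N : ℕ) : 0 ≤ lineBound p q N := by unfold lineBound; positivity

/-- ★ UNIFORM one-dimensional decay over `ℤ` (uniform in the real offset `c`): for every `N ≥ 1`,
`Σ_{i ∈ ℤ} ((p + q (i + c)²)²)⁻¹ ≤ (2N + 3) p⁻² + 2 q⁻² N⁻³`. Shift `c` to `fract c ∈ [0,1)`, then `|i + c| ≥ |i| − 1`. -/
theorem tsum_int_quadsq_le {p q : ℝ} (hp : 0 < p) (hq : 0 < q) (c : ℝ) {N : ℕ} (hN : 1 ≤ N) :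
    ∑' i : ℤ, ((p + q * ((i : ℝ) + c) ^ 2) ^ 2)⁻¹ ≤ lineBound p q N := by
  set c' : ℝ := Int.fract c with hc'
  have hc0 : 0 ≤ c' := Int.fract_nonneg c
  have hc1 : c' < 1 := Int.fract_lt_one c
  have hcc : (⌊c⌋ : ℝ) + c' = c := by rw [hc']; exact Int.floor_add_fract c
  have hshift : ∑' i : ℤ, ((p + q * ((i : ℝ) + c) ^ 2) ^ 2)⁻¹ = ∑' i : ℤ, ((p + q * ((i : ℝ) + c') ^ 2) ^ 2)⁻¹ := by
    rw [← (Equiv.addRight (-⌊c⌋)).tsum_eq]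
    refine tsum_congr fun j => ?_
    simp only [Equiv.coe_addRight, Int.cast_add, Int.cast_neg]
    rw [show (j : ℝ) + -(⌊c⌋ : ℝ) + c = (j : ℝ) + c' by linarith]
  rw [hshift]
  set f : ℕ → ℝ := fun n => ((p + q * (n : ℝ) ^ 2) ^ 2)⁻¹ with hf
  have hfs : Summable f := summable_nat_quadsq hp hq
  set F : ℤ → ℝ := fun i => ((p + q * ((i : ℝ) + c') ^ 2) ^ 2)⁻¹ with hF
  have hpos : ∀ n : ℕ, F (n + 1) ≤ f n := fun n => by
    simp only [hF, hf]; push_cast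
    exact quadsq_anti hp hq (Nat.cast_nonneg n) (by linarith)
  have hneg : ∀ n : ℕ, F (-(n + 1)) ≤ f n := fun n => by
    simp only [hF, hf]; push_cast
    rw [show (-((n : ℝ) + 1) + c') ^ 2 = ((n : ℝ) + 1 - c') ^ 2 by ring]
    exact quadsq_anti hp hq (Nat.cast_nonneg n) (by linarith)
  have hzero : F 0 ≤ f 0 := by
    simp only [hF, hf, Int.cast_zero, zero_add, Nat.cast_zero]
    exact quadsq_anti hp hq le_rfl hc0
  have hF1 : Summable fun n : ℕ => F (n + 1) := Summable.of_nonneg_of_le (fun n => by positivity) hpos hfs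
  have hF2 : Summable fun n : ℕ => F (-(n + 1)) := Summable.of_nonneg_of_le (fun n => by positivity) hneg hfs
  rw [tsum_of_add_one_of_neg_add_one hF1 hF2]
  have h1 : ∑' n : ℕ, F (n + 1) ≤ ∑' n, f n := hF1.tsum_le_tsum hpos hfs
  have h2 : ∑' n : ℕ, F (-(n + 1)) ≤ ∑' n, f n := hF2.tsum_le_tsum hneg hfs
  have h3 : ∑' n, f n = f 0 + ∑' n, f (n + 1) := hfs.tsum_eq_zero_add
  have h4 : ∑' n : ℕ, f (n + 1) ≤ N * p⁻¹ ^ 2 + q⁻¹ ^ 2 * (N : ℝ)⁻¹ ^ 3 := by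
    have := tsum_nat_succ_quadsq_le hp hq hN
    simpa [hf] using this
  have h5 : f 0 = p⁻¹ ^ 2 := by simp [hf, inv_pow]
  unfold lineBound
  linarith

/-- `Σ_{i ∈ ℤ} (1 + i²)⁻¹ < ∞` (private: tree twin `Literature.NumberTheory.LFunctions.WeilMellinPolyDecay.summable_inv_one_add_sq`, gate dedup). -/
private theorem summable_inv_one_add_sq : Summable fun i : ℤ => (1 + (i : ℝ) ^ 2)⁻¹ := by
  have hnat : Summable fun n : ℕ => (1 + (n : ℝ) ^ 2)⁻¹ := by
    have hs : Summable fun n : ℕ => 2 * (1 / ((n + 1 : ℕ) : ℝ) ^ 2) :=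
      ((summable_nat_add_iff 1).2 (Real.summable_one_div_nat_pow.2 (by norm_num : 1 < 2))).mul_left 2
    refine Summable.of_nonneg_of_le (fun n => by positivity) (fun n => ?_) hs
    push_cast
    rw [inv_eq_one_div, mul_one_div, div_le_div_iff₀ (by positivity) (by positivity)]
    nlinarith [sq_nonneg ((n : ℝ) - 1)]
  refine Summable.of_nat_of_neg (by exact_mod_cast hnat) ?_
  simpa using hnat

/-- `Σ_{i ∈ ℤ} (p + q (i + c)²)⁻¹ < ∞` for `p, q > 0`. -/
theorem summable_inv_quad {p q : ℝ} (hp : 0 < p) (hq : 0 < q) (c : ℝ) :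
    Summable fun i : ℤ => (p + q * ((i : ℝ) + c) ^ 2)⁻¹ := by
  have hm : 0 < min p q := lt_min hp hq
  refine Summable.of_nonneg_of_le (fun i => by positivity) (fun i => ?_)
    (summable_inv_one_add_sq.mul_left (2 * (1 + c ^ 2) / min p q))
  have hi : 0 < 1 + (i : ℝ) ^ 2 := by positivity
  have hL : 0 < min p q * (1 + (i : ℝ) ^ 2) / (2 * (1 + c ^ 2)) := by positivity
  have hLR : min p q * (1 + (i : ℝ) ^ 2) / (2 * (1 + c ^ 2)) ≤ p + q * ((i : ℝ) + c) ^ 2 := by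
    rw [div_le_iff₀ (by positivity)]
    nlinarith [min_le_left p q, min_le_right p q, sq_nonneg ((i : ℝ) + c), sq_nonneg (c * ((i : ℝ) + c)),
      sq_nonneg ((i : ℝ) + c + c), hm.le, mul_nonneg hm.le (sq_nonneg ((i : ℝ) + c + c)),
      mul_nonneg hm.le (sq_nonneg (c * ((i : ℝ) + c)))]
  have h := inv_anti₀ hL hLR
  have e : (min p q * (1 + (i : ℝ) ^ 2) / (2 * (1 + c ^ 2)))⁻¹ = 2 * (1 + c ^ 2) / min p q * (1 + (i : ℝ) ^ 2)⁻¹ := by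
    field_simp
  rw [e] at h; exact h

/-! ## §2 Planar site sums: uniform decay -/

/-- the planar site quadratic `S = t² + q₁ (i + c₁)² + q₂ (j + c₂)²`. -/
def siteSq (t q₁ q₂ c₁ c₂ : ℝ) (ij : ℤ × ℤ) : ℝ := t ^ 2 + q₁ * ((ij.1 : ℝ) + c₁) ^ 2 + q₂ * ((ij.2 : ℝ) + c₂) ^ 2

/-- `t² ≤ siteSq t q₁ q₂ c₁ c₂ ij` for `q₁, q₂ ≥ 0`. [folklore] -/
theorem sq_le_siteSq {t q₁ q₂ : ℝ} (hq₁ : 0 ≤ q₁) (hq₂ : 0 ≤ q₂) (c₁ c₂ : ℝ) (ij : ℤ × ℤ) :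
    t ^ 2 ≤ siteSq t q₁ q₂ c₁ c₂ ij := by
  unfold siteSq; nlinarith [mul_nonneg hq₁ (sq_nonneg ((ij.1 : ℝ) + c₁)), mul_nonneg hq₂ (sq_nonneg ((ij.2 : ℝ) + c₂))]

/-- `0 < siteSq t q₁ q₂ c₁ c₂ ij` for `t > 0`, `q₁, q₂ ≥ 0`. [folklore] -/
theorem siteSq_pos {t q₁ q₂ : ℝ} (ht : 0 < t) (hq₁ : 0 ≤ q₁) (hq₂ : 0 ≤ q₂) (c₁ c₂ : ℝ) (ij : ℤ × ℤ) :
    0 < siteSq t q₁ q₂ c₁ c₂ ij :=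
  lt_of_lt_of_le (by positivity) (sq_le_siteSq hq₁ hq₂ c₁ c₂ ij)

/-- ★ UNIFORM PLANAR DECAY, exponent 4 (product trick of `…PlanarLatticeSums` + §1): for every `N ≥ 1`,
`Σ_{(i,j)} (S⁴)⁻¹ ≤ lineBound (t²/2) q₁ N · lineBound (t²/2) q₂ N`, uniformly in `(c₁, c₂)`. -/
theorem tsum_sites_four_le {t q₁ q₂ : ℝ} (ht : 0 < t) (hq₁ : 0 < q₁) (hq₂ : 0 < q₂) (c₁ c₂ : ℝ) {N : ℕ} (hN : 1 ≤ N) :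
    ∑' ij : ℤ × ℤ, ((siteSq t q₁ q₂ c₁ c₂ ij) ^ 4)⁻¹ ≤ lineBound (t ^ 2 / 2) q₁ N * lineBound (t ^ 2 / 2) q₂ N := by
  have ht2 : 0 < t ^ 2 / 2 := by positivity
  have hf₁ := summable_inv_quad_sq ht2 hq₁ c₁
  have hf₂ := summable_inv_quad_sq ht2 hq₂ c₂
  have hprod : Summable fun ij : ℤ × ℤ =>
      ((t ^ 2 / 2 + q₁ * ((ij.1 : ℝ) + c₁) ^ 2) ^ 2)⁻¹ * ((t ^ 2 / 2 + q₂ * ((ij.2 : ℝ) + c₂) ^ 2) ^ 2)⁻¹ :=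
    hf₁.mul_of_nonneg hf₂ (fun i => by positivity) (fun j => by positivity)
  have hle : ∀ ij : ℤ × ℤ, ((siteSq t q₁ q₂ c₁ c₂ ij) ^ 4)⁻¹ ≤
      ((t ^ 2 / 2 + q₁ * ((ij.1 : ℝ) + c₁) ^ 2) ^ 2)⁻¹ * ((t ^ 2 / 2 + q₂ * ((ij.2 : ℝ) + c₂) ^ 2) ^ 2)⁻¹ :=
    fun ij => inv_pow_four_le_prod (X := t ^ 2) (by positivity) (by positivity) (by positivity)
  calc ∑' ij : ℤ × ℤ, ((siteSq t q₁ q₂ c₁ c₂ ij) ^ 4)⁻¹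
      ≤ ∑' ij : ℤ × ℤ, ((t ^ 2 / 2 + q₁ * ((ij.1 : ℝ) + c₁) ^ 2) ^ 2)⁻¹ * ((t ^ 2 / 2 + q₂ * ((ij.2 : ℝ) + c₂) ^ 2) ^ 2)⁻¹ :=
        (Summable.of_nonneg_of_le (fun ij => le_of_lt (inv_pos.2 (pow_pos (siteSq_pos ht hq₁.le hq₂.le c₁ c₂ ij) 4)))
          hle hprod).tsum_le_tsum hle hprod
    _ = (∑' i : ℤ, ((t ^ 2 / 2 + q₁ * ((i : ℝ) + c₁) ^ 2) ^ 2)⁻¹) * ∑' j : ℤ, ((t ^ 2 / 2 + q₂ * ((j : ℝ) + c₂) ^ 2) ^ 2)⁻¹ :=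
        (hf₁.tsum_mul_tsum hf₂ hprod).symm
    _ ≤ lineBound (t ^ 2 / 2) q₁ N * lineBound (t ^ 2 / 2) q₂ N :=
        mul_le_mul (tsum_int_quadsq_le ht2 hq₁ c₁ hN) (tsum_int_quadsq_le ht2 hq₂ c₂ hN)
          (tsum_nonneg fun _ => by positivity) (lineBound_nonneg _ _ _)

/-- summability of `(S⁴)⁻¹` and `(S⁷)⁻¹` (restated from `…PlanarLatticeSums`). -/
theorem summable_siteSq_four {t q₁ q₂ : ℝ} (ht : 0 < t) (hq₁ : 0 < q₁) (hq₂ : 0 < q₂) (c₁ c₂ : ℝ) :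
    Summable fun ij : ℤ × ℤ => ((siteSq t q₁ q₂ c₁ c₂ ij) ^ 4)⁻¹ :=
  summable_sites_four ht hq₁ hq₂ c₁ c₂

/-- Summability of `(siteSq …)⁻⁷` over `ℤ × ℤ` (`t, q₁, q₂ > 0`). [folklore] -/
theorem summable_siteSq_seven {t q₁ q₂ : ℝ} (ht : 0 < t) (hq₁ : 0 < q₁) (hq₂ : 0 < q₂) (c₁ c₂ : ℝ) :
    Summable fun ij : ℤ × ℤ => ((siteSq t q₁ q₂ c₁ c₂ ij) ^ 7)⁻¹ :=
  summable_sites_seven ht hq₁ hq₂ c₁ c₂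

/-- ★ UNIFORM PLANAR DECAY, exponent 7: `Σ (S⁷)⁻¹ ≤ (t²)⁻³ · lineBound · lineBound`. -/
theorem tsum_sites_seven_le {t q₁ q₂ : ℝ} (ht : 0 < t) (hq₁ : 0 < q₁) (hq₂ : 0 < q₂) (c₁ c₂ : ℝ) {N : ℕ} (hN : 1 ≤ N) :
    ∑' ij : ℤ × ℤ, ((siteSq t q₁ q₂ c₁ c₂ ij) ^ 7)⁻¹ ≤
      (t ^ 2)⁻¹ ^ 3 * (lineBound (t ^ 2 / 2) q₁ N * lineBound (t ^ 2 / 2) q₂ N) := by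
  have hle : ∀ ij : ℤ × ℤ, ((siteSq t q₁ q₂ c₁ c₂ ij) ^ 7)⁻¹ ≤ (t ^ 2)⁻¹ ^ 3 * ((siteSq t q₁ q₂ c₁ c₂ ij) ^ 4)⁻¹ :=
    fun ij => by
      have h := inv_pow_seven_le (t := t) (A := q₁ * ((ij.1 : ℝ) + c₁) ^ 2) (B := q₂ * ((ij.2 : ℝ) + c₂) ^ 2) ht
        (by positivity) (by positivity)
      rw [inv_pow]; exact h
  have hs4 := summable_siteSq_four ht hq₁ hq₂ c₁ c₂
  calc ∑' ij : ℤ × ℤ, ((siteSq t q₁ q₂ c₁ c₂ ij) ^ 7)⁻¹ ≤ ∑' ij : ℤ × ℤ, (t ^ 2)⁻¹ ^ 3 * ((siteSq t q₁ q₂ c₁ c₂ ij) ^ 4)⁻¹ :=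
        (summable_siteSq_seven ht hq₁ hq₂ c₁ c₂).tsum_le_tsum hle (hs4.mul_left _)
    _ = (t ^ 2)⁻¹ ^ 3 * ∑' ij : ℤ × ℤ, ((siteSq t q₁ q₂ c₁ c₂ ij) ^ 4)⁻¹ := tsum_mul_left
    _ ≤ (t ^ 2)⁻¹ ^ 3 * (lineBound (t ^ 2 / 2) q₁ N * lineBound (t ^ 2 / 2) q₂ N) :=
        mul_le_mul_of_nonneg_left (tsum_sites_four_le ht hq₁ hq₂ c₁ c₂ hN) (by positivity)

/-- the per-site Lipschitz modulus `Φ(t) = 15 t⁻¹⁴ + 9 t⁻⁸` of `…PairForceLipschitz.pairForce_sub_le`. -/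
def modulus (s : ℝ) : ℝ := 15 * s⁻¹ ^ 14 + 9 * s⁻¹ ^ 8

/-- `0 ≤ modulus s`. [folklore] -/
theorem modulus_nonneg (s : ℝ) : 0 ≤ modulus s := by unfold modulus; positivity

/-- The pair force is `modulus t`-Lipschitz on `{‖·‖ ≥ t}` (`pairForce_sub_le` restated with `modulus`). [folklore] -/
theorem pairForce_sub_le_modulus {x y : E3} {t : ℝ} (ht : 0 < t) (hx : t ≤ ‖x‖) (hy : t ≤ ‖y‖) :
    ‖pairForce x - pairForce y‖ ≤ modulus t * ‖x - y‖ :=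
  pairForce_sub_le ht hx hy

/-- `Φ(min(x, y)) ≤ Φ(x) + Φ(y)`. -/
theorem modulus_min_le (x y : ℝ) : modulus (min x y) ≤ modulus x + modulus y := by
  have h0x := modulus_nonneg x
  have h0y := modulus_nonneg y
  rcases le_total x y with h | h
  · rw [min_eq_left h]; linarith
  · rw [min_eq_right h]; linarith

/-- the per-site modulus at the floor `√S`. -/
theorem modulus_sqrt_eq {S : ℝ} (hS : 0 ≤ S) : modulus (Real.sqrt S) = 15 * (S ^ 7)⁻¹ + 9 * (S ^ 4)⁻¹ := by
  have h14 : (Real.sqrt S)⁻¹ ^ 14 = (S ^ 7)⁻¹ := inv_sqrt_pow_two_mul hS 7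
  have h8 : (Real.sqrt S)⁻¹ ^ 8 = (S ^ 4)⁻¹ := inv_sqrt_pow_two_mul hS 4
  rw [modulus, h14, h8]

/-- summability of the modulus over the sites (restated from `…PlanarLatticeSums`). -/
theorem summable_modulus_siteSq {t q₁ q₂ : ℝ} (ht : 0 < t) (hq₁ : 0 < q₁) (hq₂ : 0 < q₂) (c₁ c₂ : ℝ) :
    Summable fun ij : ℤ × ℤ => modulus (Real.sqrt (siteSq t q₁ q₂ c₁ c₂ ij)) :=
  summable_modulus_sites ht hq₁ hq₂ c₁ c₂

/-- ★ UNIFORM PLANAR MODULUS SUM: `Σ_{(i,j)} (15 (√S)⁻¹⁴ + 9 (√S)⁻⁸) ≤ (15 (t²)⁻³ + 9) · lineBound · lineBound`. -/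
theorem tsum_modulus_le {t q₁ q₂ : ℝ} (ht : 0 < t) (hq₁ : 0 < q₁) (hq₂ : 0 < q₂) (c₁ c₂ : ℝ) {N : ℕ} (hN : 1 ≤ N) :
    ∑' ij : ℤ × ℤ, modulus (Real.sqrt (siteSq t q₁ q₂ c₁ c₂ ij)) ≤
      (15 * (t ^ 2)⁻¹ ^ 3 + 9) * (lineBound (t ^ 2 / 2) q₁ N * lineBound (t ^ 2 / 2) q₂ N) := by
  have h7s := summable_siteSq_seven ht hq₁ hq₂ c₁ c₂
  have h4s := summable_siteSq_four ht hq₁ hq₂ c₁ c₂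
  have h7 := tsum_sites_seven_le ht hq₁ hq₂ c₁ c₂ hN
  have h4 := tsum_sites_four_le ht hq₁ hq₂ c₁ c₂ hN
  calc ∑' ij : ℤ × ℤ, modulus (Real.sqrt (siteSq t q₁ q₂ c₁ c₂ ij))
      = ∑' ij : ℤ × ℤ, (15 * ((siteSq t q₁ q₂ c₁ c₂ ij) ^ 7)⁻¹ + 9 * ((siteSq t q₁ q₂ c₁ c₂ ij) ^ 4)⁻¹) :=
        tsum_congr fun ij => modulus_sqrt_eq (siteSq_pos ht hq₁.le hq₂.le c₁ c₂ ij).le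
    _ = 15 * ∑' ij : ℤ × ℤ, ((siteSq t q₁ q₂ c₁ c₂ ij) ^ 7)⁻¹ + 9 * ∑' ij : ℤ × ℤ, ((siteSq t q₁ q₂ c₁ c₂ ij) ^ 4)⁻¹ := by
        rw [(h7s.mul_left 15).tsum_add (h4s.mul_left 9), tsum_mul_left, tsum_mul_left]
    _ ≤ 15 * ((t ^ 2)⁻¹ ^ 3 * (lineBound (t ^ 2 / 2) q₁ N * lineBound (t ^ 2 / 2) q₂ N)) +
          9 * (lineBound (t ^ 2 / 2) q₁ N * lineBound (t ^ 2 / 2) q₂ N) := by linarith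
    _ = (15 * (t ^ 2)⁻¹ ^ 3 + 9) * (lineBound (t ^ 2 / 2) q₁ N * lineBound (t ^ 2 / 2) q₂ N) := by ring

/-- `Σ_{(i,j)} (S²)⁻¹ < ∞` (product trick, exponent 2). -/
theorem summable_siteSq_two {t q₁ q₂ : ℝ} (ht : 0 < t) (hq₁ : 0 < q₁) (hq₂ : 0 < q₂) (c₁ c₂ : ℝ) :
    Summable fun ij : ℤ × ℤ => ((siteSq t q₁ q₂ c₁ c₂ ij) ^ 2)⁻¹ := by
  have ht2 : 0 < t ^ 2 / 2 := by positivity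
  have hprod := (summable_inv_quad ht2 hq₁ c₁).mul_of_nonneg (summable_inv_quad ht2 hq₂ c₂)
    (fun i => by positivity) (fun j => by positivity)
  refine Summable.of_nonneg_of_le (fun ij => by unfold siteSq; positivity) (fun ij => ?_) hprod
  have hu : 0 < t ^ 2 / 2 + q₁ * ((ij.1 : ℝ) + c₁) ^ 2 := by positivity
  have hv : 0 < t ^ 2 / 2 + q₂ * ((ij.2 : ℝ) + c₂) ^ 2 := by positivity
  have huv : (t ^ 2 / 2 + q₁ * ((ij.1 : ℝ) + c₁) ^ 2) * (t ^ 2 / 2 + q₂ * ((ij.2 : ℝ) + c₂) ^ 2) ≤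
      (siteSq t q₁ q₂ c₁ c₂ ij) ^ 2 := by
    unfold siteSq; nlinarith [mul_pos hu hv, hu.le, hv.le]
  rw [← mul_inv]
  exact inv_anti₀ (by positivity) huv

end Summit.AtomisticToContinuum.Crystallization.Theorems.ChartedPlanarOrderPairModulus
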